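import Summits.KontsevichZagierPeriods.KontsevichZagierPeriods.Theorems.KzOnePeriodsE1XiChart
import Summits.KontsevichZagierPeriods.KontsevichZagierPeriods.Theorems.SymplecticScissorsRealOnePeriodRelationsStubFormReductionPAux2

/-!
# E1 derivations, third kind, part 2: `ξ_P` on the pole chart and the exact unit-image rules as (R4)

Cell pub-kz1p (KZ 1-periods), seat 2, gen 21; continuation of `KzOnePeriodsE1XiChart.lean` (the pole
chart `E^w_{A,B}(x₀) = {y² = x³ + Ax + B, (x − x₀)w = 1} ⊂ 𝔸³`, its smoothness, the unit maps `[−1]^w`,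
`[d]^w`).  Sub-problem `KzOnePeriods` — the theorem of Huber–Wüstholz [cite: HuberWustholz2022, Thm 13.3 (2)
(p. 121)]; relations (R1)–(R5) [cite: HuberWustholz2022, §13.1 (A)–(B) (p. 120)].

* **The third-kind form as a polynomial form.**  On `E^w_{A,B}(x₀)` kz1p's `ξ_P = (y + y_P)/(x − x_P)·dx/y`,
  `P = (x₀, y₀)`, is the polynomial 1-form `ξ = (y + y₀)·w · pr^*θ₀` (`θ₀` = the tree's polynomial
  representative of `dx/y`, `Weier.theta0`; `pr = (x, y)`): on tangent vectors `(x − x₀)·y·ξ(v) =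
  (y + y₀)·dx(v)` (`xi_pair`, from `Weier.z_one_mul_theta0_apply` and part 9's chain rule `proj_pair`).
  It is defined over `ℚ̄` for `A, B, y₀ ∈ ℚ̄` (`hasAlgCoeffs_xi`), so `(E^w_{A,B}(x₀), ξ, γ^w)` is a symbol
  of the formal period space for every `C¹` path `γ^w` on the chart with algebraic end points, and its
  period is `∫_γ ξ_P` for the path `γ = pr ∘ γ^w` of `E` (which avoids `±P`).
* **Exact pull-back identities** (polynomial identities in `ℂ[x, y, w]³`, no curve equation needed; the rule
  `f^*(g·ω) = (g∘f)·f^*ω` is the tree's `TorsionLayer.formPullback_polysmul`, SymplecticScissors files):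
  `([−1]^w)^* ξ_{(x₀, −y₀)} = ξ_{(x₀, y₀)}` on `E^w_{A,B}(x₀)` (`formPullback_negW_xi`) and, for `d² = −1`,
  `([d]^w)^* ξ_{(−x₀, d y₀)} = ξ_{(x₀, y₀)}` from `E^w_{A,0}(−x₀)` to `E^w_{A,0}(x₀)` (`formPullback_cmIW_xi`) —
  kz1p's rule `[u]^* ξ_{[u]P} = ξ_P` for the units `u = −1` of every curve and `u = ±i` of `y² = x³ + Ax`.
* **Derivations.**  By `image_of_formPullback_eq` ((R4) along the unit map + (R1), `KzOnePeriodsE1CMDeriv`):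
  for EVERY path `γ` on the chart and its image `γ′ = [u]^w γ` on `[0, 1]`,
  `(E^w', ξ_{[u]P}, γ′) − (E^w, ξ_P, γ) ∈ ⟨(R1)–(R5)⟩_ℚ̄` and `∫_{γ′} ξ_{[u]P} = ∫_γ ξ_P`
  (`xi_neg_derivation`, `xi_cmI_derivation`; corpus form `corpus_xi_cmI` on `y² = x³ + ax`,
  `a ∈ {−1, −25, −1156, −36}`, and **test E1-21** `corpus_E1_21`: `ξ_{[i]A}([i]γ) = ξ_A(γ)` on
  `y² = x³ − 1156x`, `A = (578, 13872)`, `[i]A = (−578, 13872·i)` — kz1p's query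
  `(1)*xi_Ai(Tm34->Ci) + (-1)*xi_A(T34->C) = 0`, relation `IMG-A-g1-Ai-g2` of the certificate).
* **Arcs.**  An explicit `C¹` arc of `E_{A,B}` from a 2-torsion point `(e, 0)` to a point `(x_C, y_C)` along
  `x = e + (x_C − e)t²` (`exists_arcPath`); the generated case file lifts it to the chart
  (`exists_poleChartPath`) to realise kz1p's path `g1 : T34 → C` and its image `g2 = [i]g1 : Tm34 → Ci`.

No definitions (local notation only), no new axioms, no `sorry`; the one citation is the published theorem
whose relation span the E1 files instantiate.
-/

noncomputable section

open MvPolynomial Set Complex Filter Topology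
open Literature.NumberTheory.Transcendental Literature.NumberTheory.Transcendental.CurvePeriods
open Summit.KontsevichZagierPeriods.KzOnePeriods.E1Derivation
open Summit.KontsevichZagierPeriods.KzOnePeriods.G2SDerivation
open Summit.KontsevichZagierPeriods.SymplecticScissors.RealOnePeriodRelations.TorsionLayer
  (formPullback_polysmul)

namespace Summit.KontsevichZagierPeriods.KzOnePeriods.XiDerivation

local notation3 "InSpanRel " c:arg => ∃ (k : ℕ) (ρ : Fin k → (PeriodSymbol →₀ ℂ))
  (a : Fin k → ℂ), (∀ l, IsElementaryRelation (ρ l)) ∧ (∀ l, IsAlgebraic ℚ (a l)) ∧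
    c = ∑ l, a l • ρ l

/-- The symbol `(Z, ω, γ)` as an element of the formal period space. -/
local notation3 (prettyPrint := false) "Sy[" Z ", " hZ ", " ω ", " h ", " γ "]" =>
  (Finsupp.single (⟨Z, hZ, ω, h, γ⟩ : PeriodSymbol) (1 : ℂ) : PeriodSymbol →₀ ℂ)

/-- The period `∫_γ ω` of the symbol `(Z, ω, γ)`. -/
local notation3 (prettyPrint := false) "Pe[" Z ", " hZ ", " ω ", " h ", " γ "]" =>
  PeriodSymbol.period (⟨Z, hZ, ω, h, γ⟩ : PeriodSymbol)

/-- The cubic `x³ + Ax + B ∈ ℂ[x, y, w]`. -/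
local notation3 (prettyPrint := false) "fW[" A ", " B "]" =>
  ((X 0 : MvPolynomial (Fin 3) ℂ) ^ 3 + C A * X 0 + C B)

/-- The pole chart `E^w_{A,B}(x₀) = {y² = x³ + Ax + B, (x − x₀)·w = 1} ⊂ 𝔸³`. -/
local notation3 (prettyPrint := false) "EW[" A ", " B ", " x₀ "]" =>
  (⟨3, 2, ![(X 1 : MvPolynomial (Fin 3) ℂ) ^ 2 - fW[A, B], (X 0 - C x₀) * X 2 - 1]⟩ : CurveData)

/-- The projection `pr = (x, y) : E^w → E`. -/
local notation3 (prettyPrint := false) "proj" => (![X 0, X 1] : Fin 2 → MvPolynomial (Fin 3) ℂ)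

/-- `[−1]^w : (x, y, w) ↦ (x, −y, w)`. -/
local notation3 (prettyPrint := false) "negW" => (![X 0, -X 1, X 2] : Fin 3 → MvPolynomial (Fin 3) ℂ)

/-- `[d]^w : (x, y, w) ↦ (−x, d·y, −w)`. -/
local notation3 (prettyPrint := false) "cmIW[" d "]" =>
  (![-X 0, C d * X 1, -X 2] : Fin 3 → MvPolynomial (Fin 3) ℂ)

/-- **The third-kind form** `ξ_P = (y + y₀)·w · pr^*θ₀` on `E^w_{A,B}(x₀)`, `P = (x₀, y₀)`
(kz1p: `ξ_P = (y + y_P)/(x − x_P) · dx/y`). -/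
local notation3 (prettyPrint := false) "ξ[" A ", " B ", " y₀ "]" =>
  ((((X 1 : MvPolynomial (Fin 3) ℂ) + C y₀) * X 2) • formPullback proj (Weier.theta0 A B))

variable {A B x₀ : ℂ}

/-! ### Pull-backs: two polynomial identities -/

/-- `pr^*θ = (θ₀(x, y), θ₁(x, y), 0)` for a plane form `θ = θ₀ dx + θ₁ dy`. -/
theorem formPullback_proj (θ : Fin 2 → MvPolynomial (Fin 2) ℂ) :
    formPullback proj θ = ![bind₁ proj (θ 0), bind₁ proj (θ 1), 0] := by
  funext i
  simp only [formPullback, Fin.sum_univ_two, Matrix.cons_val_zero, Matrix.cons_val_one]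
  fin_cases i <;> simp [pderiv_X]

/-- `([−1]^w)^*(pr^*θ₀) = −pr^*θ₀`, exactly. -/
theorem formPullback_negW_projTheta0 (A B : ℂ) :
    formPullback negW (formPullback proj (Weier.theta0 A B)) =
      (-1 : ℂ) • formPullback proj (Weier.theta0 A B) := by
  rw [formPullback_proj]
  funext i
  simp only [formPullback, Fin.sum_univ_three, Pi.smul_apply, Matrix.cons_val_zero,
    Matrix.cons_val_one, Matrix.cons_val_two, Matrix.head_cons, Matrix.tail_cons]
  fin_cases i <;> simp [Weier.theta0, Weier.uPol, Weier.vPol, pderiv_X]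

/-- `([d]^w)^*(pr^*θ₀) = d·pr^*θ₀` on `y² = x³ + Ax`, exactly. -/
theorem formPullback_cmIW_projTheta0 (A d : ℂ) :
    formPullback cmIW[d] (formPullback proj (Weier.theta0 A 0)) =
      d • formPullback proj (Weier.theta0 A 0) := by
  rw [formPullback_proj]
  funext i
  simp only [formPullback, Fin.sum_univ_three, Pi.smul_apply, Matrix.cons_val_zero,
    Matrix.cons_val_one, Matrix.cons_val_two, Matrix.head_cons, Matrix.tail_cons]
  fin_cases i <;> simp [Weier.theta0, Weier.uPol, Weier.vPol, pderiv_X, smul_eq_C_mul] <;> ring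

/-- **`([−1]^w)^* ξ_{(x₀, −y₀)} = ξ_{(x₀, y₀)}`**, exactly (`[−1]^* ξ_{−P} = ξ_P`). -/
theorem formPullback_negW_xi (A B y₀ : ℂ) : formPullback negW ξ[A, B, -y₀] = ξ[A, B, y₀] := by
  rw [formPullback_polysmul, formPullback_negW_projTheta0]
  funext i
  simp only [Pi.smul_apply, smul_eq_mul, smul_eq_C_mul, map_mul, map_add, map_neg, map_one,
    bind₁_X_right, bind₁_C_right, Matrix.cons_val_zero, Matrix.cons_val_one, Matrix.cons_val_two,
    Matrix.head_cons, Matrix.tail_cons]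
  ring

/-- **`([d]^w)^* ξ_{(−x₀, d·y₀)} = ξ_{(x₀, y₀)}`** for `d² = −1` on `y² = x³ + Ax`, exactly
(`[i]^* ξ_{[i]P} = ξ_P`, `[i]P = (−x₀, i y₀)`). -/
theorem formPullback_cmIW_xi (A y₀ : ℂ) {d : ℂ} (hd : d ^ 2 = -1) :
    formPullback cmIW[d] ξ[A, 0, d * y₀] = ξ[A, 0, y₀] := by
  have hC : (C d : MvPolynomial (Fin 3) ℂ) * C d = -1 := by
    rw [← map_mul, ← sq, hd, map_neg, map_one]
  rw [formPullback_polysmul, formPullback_cmIW_projTheta0]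
  funext i
  simp only [Pi.smul_apply, smul_eq_mul, smul_eq_C_mul, map_mul, map_add, bind₁_X_right,
    bind₁_C_right, Matrix.cons_val_zero, Matrix.cons_val_one, Matrix.cons_val_two,
    Matrix.head_cons, Matrix.tail_cons]
  linear_combination
    (-((X 1 + C y₀) * X 2 * formPullback proj (Weier.theta0 A 0) i)) * hC

/-! ### `ξ_P` is a form over `ℚ̄`, and it is `(y + y₀)/((x − x₀)y) dx` -/

/-- `ξ` is defined over `ℚ̄` for `A, B, y₀ ∈ ℚ̄`. -/
theorem hasAlgCoeffs_xi (hA : IsAlgebraic ℚ A) (hB : IsAlgebraic ℚ B) {y₀ : ℂ}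
    (hy₀ : IsAlgebraic ℚ y₀) : ∀ i, HasAlgCoeffs (ξ[A, B, y₀] i) := fun i => by
  rw [Pi.smul_apply, smul_eq_mul]
  exact (((hasAlgCoeffs_X 1).add (hasAlgCoeffs_C hy₀)).mul (hasAlgCoeffs_X 2)).mul
    (HasAlgCoeffs.formPullback hasAlgCoeffs_proj (Weier.hasAlgCoeffs_theta0 A B hA hB) i)

/-- **`ξ_P = (y + y_P)/((x − x_P)·y) dx` on tangent vectors**: for `z ∈ E^w_{A,B}(x₀)` and `v` tangent
at `z` (`4A³ + 27B² ≠ 0`), `z₁ · ξ(z)(v) = (z₁ + y₀) z₂ · v₀` and `(z₀ − x₀) · z₁ · ξ(z)(v) = (z₁ + y₀) · v₀`. -/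
theorem xi_pair (hD : Weier.disc A B ≠ 0) (y₀ : ℂ) {z v : Fin 3 → ℂ}
    (hz : z ∈ EW[A, B, x₀].points) (hv : v ∈ EW[A, B, x₀].tangentSpace z) :
    z 1 * (∑ i, eval z (ξ[A, B, y₀] i) * v i) = (z 1 + y₀) * z 2 * v 0 ∧
      (z 0 - x₀) * (z 1 * ∑ i, eval z (ξ[A, B, y₀] i) * v i) = (z 1 + y₀) * v 0 := by
  obtain ⟨hz1, hz2⟩ := (mem_pointsEW_iff z).1 hz
  obtain ⟨hv1, -⟩ := (mem_tangentSpaceEW_iff z v).1 hv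
  have hp : (![z 0, z 1] : Fin 2 → ℂ) ∈ (weierCurve A B).points :=
    (Weier.mem_points_iff A B _).2 (by rw [Weier.eval_fPoly]; simpa using hz1)
  have hpv : (![v 0, v 1] : Fin 2 → ℂ) ∈ (weierCurve A B).tangentSpace ![z 0, z 1] := by
    rw [Weier.mem_tangentSpace_iff, Weier.eval_pderiv_zero_fPoly]
    simpa using hv1
  have hθ := Weier.z_one_mul_theta0_apply A B hp hpv hD
  simp only [Fin.sum_univ_two, Matrix.cons_val_zero, Matrix.cons_val_one] at hθ
  have hsum : ∑ i, eval z (ξ[A, B, y₀] i) * v i = (z 1 + y₀) * z 2 *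
      (eval ![z 0, z 1] (Weier.theta0 A B 0) * v 0 + eval ![z 0, z 1] (Weier.theta0 A B 1) * v 1) := by
    rw [← proj_pair (Weier.theta0 A B) z v, Finset.mul_sum]
    refine Finset.sum_congr rfl fun i _ => ?_
    simp only [Pi.smul_apply, smul_eq_mul, map_mul, map_add, eval_X, eval_C]
    ring
  refine ⟨?_, ?_⟩
  · rw [hsum]
    linear_combination ((z 1 + y₀) * z 2) * hθ
  · rw [hsum]
    linear_combination (z 0 - x₀) * ((z 1 + y₀) * z 2) * hθ + (z 1 + y₀) * v 0 * hz2

/-! ### The derivations and period identities, for every path on the chart -/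

/-- **`[−1]` and `ξ`.**  For every path `γ` on `E^w_{A,B}(x₀)` and `γ′ = [−1]^w γ = (x∘γ, −y∘γ, w∘γ)` on
`[0, 1]`: `(E^w, ξ_{(x₀,−y₀)}, γ′) − (E^w, ξ_{(x₀,y₀)}, γ) ∈ ⟨(R1)–(R5)⟩_ℚ̄` and
`∫_{γ′} ξ_{−P} = ∫_γ ξ_P` ((R4) along `[−1]^w`, (R1); Huber–Wüstholz 2022, §13.1 (A), (B)). -/
theorem xi_neg_derivation (hE : EW[A, B, x₀].IsSmoothAffineCurve) {y₀ : ℂ}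
    (hξ : ∀ i, HasAlgCoeffs (ξ[A, B, y₀] i)) (hξ' : ∀ i, HasAlgCoeffs (ξ[A, B, -y₀] i))
    {γ γ' : CurvePath EW[A, B, x₀]}
    (hγ' : ∀ t ∈ Icc (0 : ℝ) 1, γ'.toFun t = ![γ.toFun t 0, -γ.toFun t 1, γ.toFun t 2]) :
    InSpanRel (Sy[EW[A, B, x₀], hE, ξ[A, B, -y₀], hξ', γ'] - Sy[EW[A, B, x₀], hE, ξ[A, B, y₀], hξ, γ]) ∧
      Pe[EW[A, B, x₀], hE, ξ[A, B, -y₀], hξ', γ'] = Pe[EW[A, B, x₀], hE, ξ[A, B, y₀], hξ, γ] := by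
  have hγ : ∀ t ∈ Icc (0 : ℝ) 1, γ'.toFun t = fun j => eval (γ.toFun t) ((negW) j) :=
    fun t ht => (hγ' t ht).trans (eval_negW _).symm
  have h := image_of_formPullback_eq hE hE _ hasAlgCoeffs_negW negW_mem _ hξ' _ hξ isAlgebraic_one
    ((formPullback_negW_xi A B y₀).trans (one_smul ℂ _).symm) hγ
  simpa only [one_smul, one_mul] using h

/-- **`[d]` and `ξ` (`d² = −1`, `y² = x³ + Ax`).**  For every path `γ` on `E^w_{A,0}(x₀)` and
`γ′ = [d]^w γ = (−x∘γ, d·y∘γ, −w∘γ)` on `[0, 1]` (a path on `E^w_{A,0}(−x₀)`):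
`(E^w(−x₀), ξ_{(−x₀, d y₀)}, γ′) − (E^w(x₀), ξ_{(x₀, y₀)}, γ) ∈ ⟨(R1)–(R5)⟩_ℚ̄` and
`∫_{γ′} ξ_{[d]P} = ∫_γ ξ_P` ((R4) along `[d]^w`, (R1)). -/
theorem xi_cmI_derivation {d : ℂ} (hd : d ^ 2 = -1) (hE : EW[A, 0, x₀].IsSmoothAffineCurve)
    (hE' : EW[A, 0, -x₀].IsSmoothAffineCurve) {y₀ : ℂ} (hξ : ∀ i, HasAlgCoeffs (ξ[A, 0, y₀] i))
    (hξ' : ∀ i, HasAlgCoeffs (ξ[A, 0, d * y₀] i)) {γ : CurvePath EW[A, 0, x₀]}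
    {γ' : CurvePath EW[A, 0, -x₀]}
    (hγ' : ∀ t ∈ Icc (0 : ℝ) 1, γ'.toFun t = ![-γ.toFun t 0, d * γ.toFun t 1, -γ.toFun t 2]) :
    InSpanRel (Sy[EW[A, 0, -x₀], hE', ξ[A, 0, d * y₀], hξ', γ'] -
        Sy[EW[A, 0, x₀], hE, ξ[A, 0, y₀], hξ, γ]) ∧
      Pe[EW[A, 0, -x₀], hE', ξ[A, 0, d * y₀], hξ', γ'] = Pe[EW[A, 0, x₀], hE, ξ[A, 0, y₀], hξ, γ] := by
  have hγ : ∀ t ∈ Icc (0 : ℝ) 1, γ'.toFun t = fun j => eval (γ.toFun t) ((cmIW[d]) j) :=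
    fun t ht => (hγ' t ht).trans (eval_cmIW d _).symm
  have h := image_of_formPullback_eq hE hE' _ (hasAlgCoeffs_cmIW hd) (cmIW_mem hd) _ hξ' _ hξ
    isAlgebraic_one ((formPullback_cmIW_xi A y₀ hd).trans (one_smul ℂ _).symm) hγ
  simpa only [one_smul, one_mul] using h

/-! ### The corpus curves `y² = x³ + ax` and test E1-21 -/

/-- The pole charts of the corpus curves `y² = x³ + ax`, `a ∈ {−1, −25, −1156, −36}`, at algebraic `x₀`
are smooth affine curves over `ℚ̄`. -/
theorem corpus_smoothEW {a : ℂ} (ha : a = -1 ∨ a = -25 ∨ a = -1156 ∨ a = -36)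
    (hx₀ : IsAlgebraic ℚ x₀) : EW[a, 0, x₀].IsSmoothAffineCurve :=
  smoothEW (corpus_a ha).1 isAlgebraic_zero (disc_ne_zero_left (corpus_a ha).2) hx₀

/-- `ξ` on the corpus curves is defined over `ℚ̄` for algebraic `y₀`. -/
theorem corpus_xi {a : ℂ} (ha : a = -1 ∨ a = -25 ∨ a = -1156 ∨ a = -36) {y₀ : ℂ}
    (hy₀ : IsAlgebraic ℚ y₀) : ∀ i, HasAlgCoeffs (ξ[a, 0, y₀] i) :=
  hasAlgCoeffs_xi (corpus_a ha).1 isAlgebraic_zero hy₀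

/-- `i·y₀` is algebraic for algebraic `y₀`. -/
theorem isAlgebraic_I_mul {y₀ : ℂ} (hy₀ : IsAlgebraic ℚ y₀) : IsAlgebraic ℚ (I * y₀) :=
  (isAlgebraic_of_sq_eq_neg_one I_sq).mul hy₀

/-- **Third kind, exact unit images** (tests E1-21, E1-22; kz1p relation `IMG`): on `y² = x³ + ax`,
`a ∈ {−1, −25, −1156, −36}`, for every algebraic `P = (x₀, y₀)`, EVERY `C¹` path `γ` on the chart
`E^w(x₀)` with algebraic end points and its image `γ′ = [i]^w γ = (−x∘γ, i·y∘γ, −w∘γ)` on `[0, 1]`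
(which exists, `exists_cmIWPath`): `(E^w(−x₀), ξ_{[i]P}, γ′) − (E^w(x₀), ξ_P, γ) ∈ ⟨(R1)–(R5)⟩_ℚ̄` and
`∫_{γ′} ξ_{[i]P} = ∫_γ ξ_P`, `[i]P = (−x₀, i y₀)`. -/
theorem corpus_xi_cmI {a : ℂ} (ha : a = -1 ∨ a = -25 ∨ a = -1156 ∨ a = -36) {y₀ : ℂ}
    (hx₀ : IsAlgebraic ℚ x₀) (hy₀ : IsAlgebraic ℚ y₀) {γ : CurvePath EW[a, 0, x₀]}
    {γ' : CurvePath EW[a, 0, -x₀]}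
    (hγ' : ∀ t ∈ Icc (0 : ℝ) 1, γ'.toFun t = ![-γ.toFun t 0, I * γ.toFun t 1, -γ.toFun t 2]) :
    InSpanRel (Sy[EW[a, 0, -x₀], corpus_smoothEW ha hx₀.neg, ξ[a, 0, I * y₀],
          corpus_xi ha (isAlgebraic_I_mul hy₀), γ'] -
        Sy[EW[a, 0, x₀], corpus_smoothEW ha hx₀, ξ[a, 0, y₀], corpus_xi ha hy₀, γ]) ∧
      Pe[EW[a, 0, -x₀], corpus_smoothEW ha hx₀.neg, ξ[a, 0, I * y₀],
          corpus_xi ha (isAlgebraic_I_mul hy₀), γ'] =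
        Pe[EW[a, 0, x₀], corpus_smoothEW ha hx₀, ξ[a, 0, y₀], corpus_xi ha hy₀, γ] :=
  xi_cmI_derivation I_sq _ _ _ _ hγ'

/-- `y² = x³ − 1156x` is a corpus curve. -/
theorem corpus_1156 : (-1156 : ℂ) = -1 ∨ (-1156 : ℂ) = -25 ∨ (-1156 : ℂ) = -1156 ∨ (-1156 : ℂ) = -36 :=
  Or.inr (Or.inr (Or.inl rfl))

/-- **Test E1-21** (kz1p query `(1)*xi_Ai(Tm34->Ci) + (-1)*xi_A(T34->C) = 0`, verdict `relation`,
certificate relation `IMG-A-g1-Ai-g2`: `[u]^* ξ_{[u]P} = ξ_P exactly, g2 = [u]∘g1`): on `y² = x³ − 1156x`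
with `A = (578, 13872)`, `[i]A = (−578, 13872·i)`, for EVERY `C¹` path `γ` on the chart `x ≠ 578` with
algebraic end points (kz1p's `g1 : T34 = (34, 0) → C = (162, −2016)` is one, part `exists_arcPath` +
`exists_poleChartPath`) and `γ′ = [i]^w γ` on `[0, 1]` (kz1p's `g2 = [i]g1 : Tm34 → Ci`):
`(E^w(−578), ξ_{[i]A}, γ′) − (E^w(578), ξ_A, γ) ∈ ⟨(R1)–(R5)⟩_ℚ̄` and `ξ_{[i]A}(γ′) − ξ_A(γ) = 0`. -/
theorem corpus_E1_21 {γ : CurvePath EW[-1156, 0, 578]} {γ' : CurvePath EW[-1156, 0, -578]}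
    (hγ' : ∀ t ∈ Icc (0 : ℝ) 1, γ'.toFun t = ![-γ.toFun t 0, I * γ.toFun t 1, -γ.toFun t 2]) :
    InSpanRel (Sy[EW[-1156, 0, -578], corpus_smoothEW corpus_1156 (isAlgebraic_nat 578).neg,
          ξ[-1156, 0, I * 13872], corpus_xi corpus_1156 (isAlgebraic_I_mul (isAlgebraic_nat 13872)), γ'] -
        Sy[EW[-1156, 0, 578], corpus_smoothEW corpus_1156 (isAlgebraic_nat 578), ξ[-1156, 0, 13872],
          corpus_xi corpus_1156 (isAlgebraic_nat 13872), γ]) ∧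
      Pe[EW[-1156, 0, -578], corpus_smoothEW corpus_1156 (isAlgebraic_nat 578).neg,
          ξ[-1156, 0, I * 13872], corpus_xi corpus_1156 (isAlgebraic_I_mul (isAlgebraic_nat 13872)), γ'] -
        Pe[EW[-1156, 0, 578], corpus_smoothEW corpus_1156 (isAlgebraic_nat 578), ξ[-1156, 0, 13872],
          corpus_xi corpus_1156 (isAlgebraic_nat 13872), γ] = 0 := by
  have h := corpus_xi_cmI corpus_1156 (isAlgebraic_nat 578) (isAlgebraic_nat 13872) hγ'
  exact ⟨h.1, sub_eq_zero.2 h.2⟩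

/-! ### An arc of `E_{A,B}` from a 2-torsion point -/

/-- **An arc from a 2-torsion point.**  Let `A, B, e, x_C, y_C` be real, `(e, 0)` and `(x_C, y_C)` points
of `E_{A,B}` (`e³ + Ae + B = 0`, so `x³ + Ax + B = (x − e)·m(x)`, `m(x) = x² + ex + A + e²`), with
`m > 0` between `e` and `x_C`, and `e, x_C, y_C ∈ ℚ̄`.  Then `X = e + (x_C − e)t²`,
`Y = y_C · t · √(m(X)) / √(m(x_C))` is a `C¹` path on `E_{A,B}` from `(e, 0)` (`t = 0`) to `(x_C, y_C)`
(`t = 1`) with `X` between `e` and `x_C` on `[0, 1]` (`Y² = (x_C − e)t²·m(X) = (X − e)·m(X)`, since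
`y_C² = (x_C − e)·m(x_C)`). -/
theorem exists_arcPath {Ar Br e xC yC : ℝ} (hA : A = Ar) (hB : B = Br)
    (he : e ^ 3 + Ar * e + Br = 0) (hC : yC ^ 2 = xC ^ 3 + Ar * xC + Br)
    (hm : ∀ X ∈ uIcc e xC, 0 < X ^ 2 + e * X + (Ar + e ^ 2))
    (hea : IsAlgebraic ℚ (e : ℂ)) (hxa : IsAlgebraic ℚ (xC : ℂ)) (hya : IsAlgebraic ℚ (yC : ℂ)) :
    ∃ (X Y : ℝ → ℝ) (γ : CurvePath (weierCurve A B)),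
      (∀ t, γ.toFun t = ![(X t : ℂ), (Y t : ℂ)]) ∧ (∀ t, X t = e + (xC - e) * t ^ 2) ∧
      (X 0 = e ∧ Y 0 = 0) ∧ (X 1 = xC ∧ Y 1 = yC) ∧ ∀ t ∈ Icc (0 : ℝ) 1, X t ∈ uIcc e xC := by
  subst hA hB
  obtain ⟨X, hX⟩ : ∃ X : ℝ → ℝ, X = fun t => e + (xC - e) * t ^ 2 := ⟨_, rfl⟩
  have hXt : ∀ t, X t = e + (xC - e) * t ^ 2 := fun t => by rw [hX]
  have hfac : ∀ x : ℝ, x ^ 3 + Ar * x + Br = (x - e) * (x ^ 2 + e * x + (Ar + e ^ 2)) := fun x => by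
    linear_combination he
  have hXb : ∀ t ∈ Icc (0 : ℝ) 1, X t ∈ uIcc e xC := by
    intro t ht
    have ht2 : 0 ≤ t ^ 2 := sq_nonneg t
    have ht2' : t ^ 2 ≤ 1 := by nlinarith [ht.1, ht.2]
    rw [Set.mem_uIcc, hXt]
    rcases le_or_gt e xC with h | h
    · left
      constructor <;> nlinarith [mul_nonneg (sub_nonneg.2 h) ht2,
        mul_nonneg (sub_nonneg.2 h) (sub_nonneg.2 ht2')]
    · right
      constructor <;> nlinarith [mul_nonneg (sub_nonneg.2 h.le) ht2,
        mul_nonneg (sub_nonneg.2 h.le) (sub_nonneg.2 ht2')]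
  have hmC : 0 < xC ^ 2 + e * xC + (Ar + e ^ 2) := hm xC right_mem_uIcc
  have hmt : ∀ t ∈ Icc (0 : ℝ) 1, 0 < X t ^ 2 + e * X t + (Ar + e ^ 2) := fun t ht => hm _ (hXb t ht)
  have hV0 : √(xC ^ 2 + e * xC + (Ar + e ^ 2)) ≠ 0 := (Real.sqrt_pos.2 hmC).ne'
  obtain ⟨Y, hY⟩ : ∃ Y : ℝ → ℝ, Y = fun t =>
      yC * t * √(X t ^ 2 + e * X t + (Ar + e ^ 2)) / √(xC ^ 2 + e * xC + (Ar + e ^ 2)) := ⟨_, rfl⟩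
  have hYt : ∀ t, Y t =
      yC * t * √(X t ^ 2 + e * X t + (Ar + e ^ 2)) / √(xC ^ 2 + e * xC + (Ar + e ^ 2)) :=
    fun t => by rw [hY]
  have hXC : ContDiff ℝ 1 X := by
    rw [hX]
    exact contDiff_const.add (contDiff_const.mul (contDiff_id.pow 2))
  have hmXC : ContDiff ℝ 1 fun t => X t ^ 2 + e * X t + (Ar + e ^ 2) :=
    ((hXC.pow 2).add (contDiff_const.mul hXC)).add contDiff_const
  have hYC : ContDiffOn ℝ 1 Y (Icc 0 1) := by
    rw [hY]
    exact (((contDiff_const.mul contDiff_id).contDiffOn).mul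
      (hmXC.contDiffOn.sqrt fun t ht => (hmt t ht).ne')).div_const _
  -- the curve equation on `[0, 1]`
  have hC' : yC ^ 2 = (xC - e) * (xC ^ 2 + e * xC + (Ar + e ^ 2)) := by rw [hC, hfac]
  have hcurve : ∀ t ∈ Icc (0 : ℝ) 1, Y t ^ 2 = X t ^ 3 + Ar * X t + Br := by
    intro t ht
    have hW : (√(X t ^ 2 + e * X t + (Ar + e ^ 2))) ^ 2 = X t ^ 2 + e * X t + (Ar + e ^ 2) :=
      Real.sq_sqrt (hmt t ht).le
    have hV : (√(xC ^ 2 + e * xC + (Ar + e ^ 2))) ^ 2 = xC ^ 2 + e * xC + (Ar + e ^ 2) :=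
      Real.sq_sqrt hmC.le
    rw [hYt, div_pow, mul_pow, mul_pow, hW, hV, div_eq_iff hmC.ne', hfac (X t), hC', hXt]
    ring
  have hx0 : X 0 = e := by rw [hXt]; ring
  have hx1 : X 1 = xC := by rw [hXt]; ring
  have hy0 : Y 0 = 0 := by rw [hYt]; simp
  have hy1 : Y 1 = yC := by rw [hYt, hx1, mul_one, mul_div_assoc, div_self hV0, mul_one]
  obtain ⟨φ, hφ⟩ : ∃ φ : ℝ → Fin 2 → ℂ, φ = fun t => ![(X t : ℂ), (Y t : ℂ)] := ⟨_, rfl⟩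
  have e0 : (fun t : ℝ => ((X t : ℝ) : ℂ)) = ⇑Complex.ofRealCLM ∘ X := by funext t; simp
  have e1 : (fun t : ℝ => ((Y t : ℝ) : ℂ)) = ⇑Complex.ofRealCLM ∘ Y := by funext t; simp
  refine ⟨X, Y, { toFun := φ
                  contDiffOn := ?_
                  mem_points := ?_
                  algebraic_zero := ?_
                  algebraic_one := ?_ }, fun t => by show φ t = _; rw [hφ], hXt,
    ⟨hx0, hy0⟩, ⟨hx1, hy1⟩, hXb⟩
  · rw [contDiffOn_pi]
    intro j
    rw [hφ]
    fin_cases j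
    · simp only [Fin.zero_eta, Matrix.cons_val_zero]
      rw [e0]
      exact (Complex.ofRealCLM.contDiff.comp hXC).contDiffOn
    · simp only [Fin.mk_one, Matrix.cons_val_one, Matrix.cons_val_zero]
      rw [e1]
      exact Complex.ofRealCLM.contDiff.comp_contDiffOn hYC
  · intro t ht
    rw [Weier.mem_points_iff, Weier.eval_fPoly, hφ]
    simp only [Matrix.cons_val_zero, Matrix.cons_val_one]
    exact_mod_cast hcurve t ht
  · intro i
    rw [hφ]
    fin_cases i
    · simpa [hx0] using hea
    · simpa [hy0] using (isAlgebraic_zero : IsAlgebraic ℚ (0 : ℂ))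
  · intro i
    rw [hφ]
    fin_cases i
    · simpa [hx1] using hxa
    · simpa [hy1] using hya

end Summit.KontsevichZagierPeriods.KzOnePeriods.XiDerivation

end
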